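import Literature.AlgebraicGeometry.Resolution.HilbertSamuelSemicontinuityExcellentDim
import Literature.AlgebraicGeometry.Resolution.MaxStratumStrictTransform
import HarnessLib

/-!
# CJS Thm. 2.33 and Lemma 2.36 on QUASI-excellent schemes with catenary local rings
# (the form inherited by blow-ups of excellent schemes)

Topic: `Literature/AlgebraicGeometry/Resolution`. Cossart–Jannsen–Saito, LNM 2270, Thm. 2.33 ("Let
`X` be a locally noetherian catenary scheme. (1) … `H_X(x) ≥ H_X(y)` … assume in addition that
`X` is excellent (it suffices that `X` is quasi-excellent) (2) … (3) `H_X` is upper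
semi-continuous") and Lemma 2.36 (the strata are locally closed, `X_max` is closed, `Σ_X` is
finite). `HilbertSamuelSemicontinuityExcellent*.lean` prove these on EXCELLENT schemes; excellence
enters only through the G-ring and J-2 properties of the affine rings (quasi-excellence) and the
catenarity of the local rings — exactly as in the printed hypotheses just quoted. A blow-up `X'`
of an excellent scheme is quasi-excellent (`IsBlowup.isQuasiExcellent`) with universally catenary
local rings (`IsBlowup.isUniversallyCatenaryRing_stalk`), while its excellence is not recorded in
the tree; this file therefore PROVES the whole package under "`X` quasi-excellent with catenary
local rings":

* `Scheme.exists_isOpen_hsFun_eq_of_isQuasiExcellent`, `Scheme.finite_hsValues_of_isQuasiExcellent`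
  — Thm. 2.33 (2) and Lemma 2.36 (b) (`Σ_X` finite, `N ≥ ψ_X`);
* `Scheme.isClosed_hsStratumGE_of_isQuasiExcellent` — Thm. 2.33 (3) (`N > ψ_X`; Thm. 2.33 (1) is
  `Scheme.hsFun_le_hsFun_of_specializes_of_isQuasiExcellent` of `MaxStratumStrictTransform.lean`);
* `Scheme.isLocallyClosed_hsStratum_of_isQuasiExcellent`, `Scheme.closure_hsStratum_subset_of_isQuasiExcellent`,
  `Scheme.isClosed_hsStratum_of_maximal_of_isQuasiExcellent`, `Scheme.isClosed_hsMaxLocus_of_isQuasiExcellent`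
  — Lemma 2.36 (a);
* `…_of_dim` forms with `N > dim X`.

No definitions and no named facts are introduced.

## Sources

* V. Cossart, U. Jannsen, S. Saito, *Desingularization: Invariants and Strategy*, LNM 2270
  (2020), Thm. 2.33, Lemma 2.34, Lemma 2.36. [CossartJannsenSaito2020]
* H. Matsumura, *Commutative Ring Theory* (1986), §32 (quasi-excellent rings). [Matsumura1987]
-/

noncomputable section

open CategoryTheory AlgebraicGeometry IsLocalRing
open Literature.RingTheory.HilbertSamuel

namespace Literature.AlgebraicGeometry.Resolution

universe u

variable {X : Scheme.{u}}

/-! ## Thm. 2.33 (1), (2) and Lemma 2.36 (b) -/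

/-- **CJS Thm. 2.33 (2) on a quasi-excellent scheme with catenary local rings**: for `y ∈ X` and
`N ≥ ψ_X` along `cl{y}` there is an open `U ∋ y` with `H_X(x) = H_X(y)` for all `x ∈ U ∩ cl{y}`.
[cite: CossartJannsenSaito2020, Thm. 2.33 (2)] -/
theorem Scheme.exists_isOpen_hsFun_eq_of_isQuasiExcellent [IsLocallyNoetherian X]
    (hX : Scheme.IsQuasiExcellent X) (hcat : ∀ x : X, IsCatenaryRing (X.presheaf.stalk x)) (N : ℕ)
    (y : X) (hN : ∀ x : X, y ⤳ x → Scheme.hsPsi X x ≤ N) :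
    ∃ U : X.Opens, y ∈ U ∧ ∀ x ∈ U, ∀ h : y ⤳ x, Scheme.hsFun X N x = Scheme.hsFun X N y :=
  Scheme.exists_isOpen_hsFun_eq N y (fun x _ => hcat x)
    (Scheme.exists_isOpen_isRegularLocalRing_quotient_primeOfSpecializes hX y) hN

/-- **`Σ_X` is finite on a noetherian quasi-excellent scheme with catenary local rings** (CJS
Lemma 2.36 (b); `N ≥ ψ_X`). [cite: CossartJannsenSaito2020, Lemma 2.36 (b), Lemma 2.34 (c)] -/
theorem Scheme.finite_hsValues_of_isQuasiExcellent [IsNoetherian X] (hX : Scheme.IsQuasiExcellent X)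
    (hcat : ∀ x : X, IsCatenaryRing (X.presheaf.stalk x)) (N : ℕ)
    (hN : ∀ x : X, Scheme.hsPsi X x ≤ N) : (Scheme.hsValues X N).Finite := by
  refine Literature.Topology.NoetherianSpaces.finite_range_of_eqOn_nhds_generic
    (Scheme.hsFun X N) fun y => ?_
  obtain ⟨U, hyU, hU⟩ := Scheme.exists_isOpen_hsFun_eq_of_isQuasiExcellent hX hcat N y fun x _ => hN x
  exact ⟨U, U.2, hyU, fun x hxU hx => hU x hxU (specializes_iff_mem_closure.mpr hx)⟩

/-! ## Thm. 2.33 (3) and Lemma 2.36 (a) -/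

/-- **CJS Thm. 2.33 (3) on a noetherian quasi-excellent scheme with catenary local rings**: every
`X(≥ ν)` is closed (`N > ψ_X`). [cite: CossartJannsenSaito2020, Thm. 2.33 (3), Lemma 2.34 (a)] -/
theorem Scheme.isClosed_hsStratumGE_of_isQuasiExcellent [IsNoetherian X]
    (hX : Scheme.IsQuasiExcellent X) (hcat : ∀ x : X, IsCatenaryRing (X.presheaf.stalk x)) (N : ℕ)
    (hN : ∀ x : X, Scheme.hsPsi X x < N) (ν : ℕ → ℕ) : IsClosed (Scheme.hsStratumGE X N ν) := by
  refine Literature.Topology.NoetherianSpaces.isClosed_setOf_le_of_specializes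
    (Scheme.hsFun X N)
    (fun x _ h => Scheme.hsFun_le_hsFun_of_specializes_of_isQuasiExcellent hX N h (hcat x) (hN x))
    (fun y => ?_) ν
  obtain ⟨U, hyU, hU⟩ := Scheme.exists_isOpen_hsFun_eq_of_isQuasiExcellent hX hcat N y
    fun x _ => (hN x).le
  exact ⟨U, U.2, hyU, fun x hxU hx => hU x hxU (specializes_iff_mem_closure.mpr hx)⟩

/-- **CJS Lemma 2.36 (a)**: the strata `X(ν)` are locally closed (noetherian quasi-excellent `X`
with catenary local rings, `N > ψ_X`). [cite: CossartJannsenSaito2020, Lemma 2.36 (a)] -/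
theorem Scheme.isLocallyClosed_hsStratum_of_isQuasiExcellent [IsNoetherian X]
    (hX : Scheme.IsQuasiExcellent X) (hcat : ∀ x : X, IsCatenaryRing (X.presheaf.stalk x)) (N : ℕ)
    (hN : ∀ x : X, Scheme.hsPsi X x < N) (ν : ℕ → ℕ) : IsLocallyClosed (Scheme.hsStratum X N ν) :=
  Scheme.isLocallyClosed_hsStratum (Scheme.isClosed_hsStratumGE_of_isQuasiExcellent hX hcat N hN)
    (Scheme.finite_hsValues_of_isQuasiExcellent hX hcat N fun x => (hN x).le) ν

/-- **CJS Lemma 2.36 (a)**: the closure of `X(ν)` lies in `X(≥ ν)` (same hypotheses).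
[cite: CossartJannsenSaito2020, Lemma 2.36 (a)] -/
theorem Scheme.closure_hsStratum_subset_of_isQuasiExcellent [IsNoetherian X]
    (hX : Scheme.IsQuasiExcellent X) (hcat : ∀ x : X, IsCatenaryRing (X.presheaf.stalk x)) (N : ℕ)
    (hN : ∀ x : X, Scheme.hsPsi X x < N) (ν : ℕ → ℕ) :
    closure (Scheme.hsStratum X N ν) ⊆ Scheme.hsStratumGE X N ν :=
  Scheme.closure_hsStratum_subset (Scheme.isClosed_hsStratumGE_of_isQuasiExcellent hX hcat N hN) ν

/-- **CJS Lemma 2.36 (a)**: `X(ν)` is closed for `ν ∈ Σ_X^max` (same hypotheses).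
[cite: CossartJannsenSaito2020, Lemma 2.36 (a)] -/
theorem Scheme.isClosed_hsStratum_of_maximal_of_isQuasiExcellent [IsNoetherian X]
    (hX : Scheme.IsQuasiExcellent X) (hcat : ∀ x : X, IsCatenaryRing (X.presheaf.stalk x)) (N : ℕ)
    (hN : ∀ x : X, Scheme.hsPsi X x < N) {ν : ℕ → ℕ} (hν : Maximal (· ∈ Scheme.hsValues X N) ν) :
    IsClosed (Scheme.hsStratum X N ν) :=
  Scheme.isClosed_hsStratum_of_maximal (Scheme.isClosed_hsStratumGE_of_isQuasiExcellent hX hcat N hN) hν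

/-- **CJS Lemma 2.36 (a): `X_max` is closed** on a noetherian quasi-excellent scheme with catenary
local rings (`N > ψ_X`). [cite: CossartJannsenSaito2020, Lemma 2.36 (a)] -/
theorem Scheme.isClosed_hsMaxLocus_of_isQuasiExcellent [IsNoetherian X]
    (hX : Scheme.IsQuasiExcellent X) (hcat : ∀ x : X, IsCatenaryRing (X.presheaf.stalk x)) (N : ℕ)
    (hN : ∀ x : X, Scheme.hsPsi X x < N) : IsClosed (Scheme.hsMaxLocus X N) :=
  Scheme.isClosed_hsMaxLocus (Scheme.isClosed_hsStratumGE_of_isQuasiExcellent hX hcat N hN)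
    (Scheme.finite_hsValues_of_isQuasiExcellent hX hcat N fun x => (hN x).le)

/-! ## `N > dim X` -/

/-- **Thm. 2.33 (1)**, quasi-excellent with catenary `𝒪_{X,x}`, `N > dim X`.
[cite: CossartJannsenSaito2020, Thm. 2.33 (1)] -/
theorem Scheme.hsFun_le_hsFun_of_specializes_of_isQuasiExcellent_of_dim [IsLocallyNoetherian X]
    (hX : Scheme.IsQuasiExcellent X) {N : ℕ} (hdim : topologicalKrullDim X < N) {x y : X} (h : y ⤳ x)
    (hcat : IsCatenaryRing (X.presheaf.stalk x)) : Scheme.hsFun X N y ≤ Scheme.hsFun X N x :=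
  Scheme.hsFun_le_hsFun_of_specializes_of_isQuasiExcellent hX N h hcat (Scheme.hsPsi_lt_of_dim_lt hdim x)

/-- **Lemma 2.36 (b)**, `N > dim X`: `Σ_X` is finite (noetherian quasi-excellent, catenary local
rings). [cite: CossartJannsenSaito2020, Lemma 2.36 (b)] -/
theorem Scheme.finite_hsValues_of_isQuasiExcellent_of_dim [IsNoetherian X]
    (hX : Scheme.IsQuasiExcellent X) (hcat : ∀ x : X, IsCatenaryRing (X.presheaf.stalk x)) {N : ℕ}
    (hdim : topologicalKrullDim X < N) : (Scheme.hsValues X N).Finite :=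
  Scheme.finite_hsValues_of_isQuasiExcellent hX hcat N fun x => (Scheme.hsPsi_lt_of_dim_lt hdim x).le

/-- **Thm. 2.33 (3)**, `N > dim X`: every `X(≥ ν)` is closed.
[cite: CossartJannsenSaito2020, Thm. 2.33 (3)] -/
theorem Scheme.isClosed_hsStratumGE_of_isQuasiExcellent_of_dim [IsNoetherian X]
    (hX : Scheme.IsQuasiExcellent X) (hcat : ∀ x : X, IsCatenaryRing (X.presheaf.stalk x)) {N : ℕ}
    (hdim : topologicalKrullDim X < N) (ν : ℕ → ℕ) : IsClosed (Scheme.hsStratumGE X N ν) :=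
  Scheme.isClosed_hsStratumGE_of_isQuasiExcellent hX hcat N (Scheme.hsPsi_lt_of_dim_lt hdim) ν

/-- **Lemma 2.36 (a)**, `N > dim X`: the strata are locally closed.
[cite: CossartJannsenSaito2020, Lemma 2.36 (a)] -/
theorem Scheme.isLocallyClosed_hsStratum_of_isQuasiExcellent_of_dim [IsNoetherian X]
    (hX : Scheme.IsQuasiExcellent X) (hcat : ∀ x : X, IsCatenaryRing (X.presheaf.stalk x)) {N : ℕ}
    (hdim : topologicalKrullDim X < N) (ν : ℕ → ℕ) : IsLocallyClosed (Scheme.hsStratum X N ν) :=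
  Scheme.isLocallyClosed_hsStratum_of_isQuasiExcellent hX hcat N (Scheme.hsPsi_lt_of_dim_lt hdim) ν

/-- **Lemma 2.36 (a)**, `N > dim X`: `X_max` is closed.
[cite: CossartJannsenSaito2020, Lemma 2.36 (a)] -/
theorem Scheme.isClosed_hsMaxLocus_of_isQuasiExcellent_of_dim [IsNoetherian X]
    (hX : Scheme.IsQuasiExcellent X) (hcat : ∀ x : X, IsCatenaryRing (X.presheaf.stalk x)) {N : ℕ}
    (hdim : topologicalKrullDim X < N) : IsClosed (Scheme.hsMaxLocus X N) :=
  Scheme.isClosed_hsMaxLocus_of_isQuasiExcellent hX hcat N (Scheme.hsPsi_lt_of_dim_lt hdim)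

end Literature.AlgebraicGeometry.Resolution
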